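import Summits.BirchSwinnertonDyer.BirchSwinnertonDyer.Theorems.GenusKolyvaginAtTwoPowDvdShaCardAtTwoPosTE4PosOfSockets
import Summits.BirchSwinnertonDyer.BirchSwinnertonDyer.Theorems.GenusKolyvaginAtTwoPowDvdShaCardAtTwoPosTBottomRungSocketTransposition
import Summits.BirchSwinnertonDyer.BirchSwinnertonDyer.Theorems.GenusKolyvaginAtTwoPowDvdShaCardAtTwoPosTBottomRungTransverseSocketTransposition
import HarnessLib

/-!
# Route `GenusKolyvaginAtTwo`, LINE 26 «lw2_phantom_exclusion» of the residual crux `OffCutResidualAtTwoR` (stmt-BirchSwinnertonDyer-31767):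
# the FLAT re-thread — part G1: **the Δ>0 sockets and the (E4)⁺ capstone-with-sockets, from `(NPh at 2N)` instead of an odd multiplicative prime**

Seat `bsd-line-gk2-p5` g40 (WIDTH-5 attach, cell `bsd-f1-sign2`), `--supports stmt-BirchSwinnertonDyer-31767` (helper; closes nothing).
THEOREMS ONLY (no definition, no named fact, no `sorry`).  **BSD is NOT proved by any of this**; the residual crux is NOT closed by it.

WHY.  LINE 26 (`Cruxes/OffCutResidualAtTwoR/Lines/lw2_phantom_exclusion.lean`, stubs `stub_Q3flat` / `stub_Q4flat`) asks for the LANDED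
exactness theorems Q3R_T (`…Theorems.equivariantKolyvaginExactAtTwoRT_proof`) and Q4_T″ (`…Theorems.kolyvaginExactAtTwoPosDiscT_proof`) with
their binder quadruple `(v) (h2v : 2 ∉ v) (hNv : N ∈ v) (hmult : E multiplicative at v)` REPLACED by the hypothesis it was only ever used to
derive (critic #471 P1 census, card §7: 10 entry points, 36 pass-through signatures, 0 other uses of `v`):
`(NPh at 2N)(E, K)` := «for every `M ≥ 1`, a class of `H¹(K, E[2^M])` that dies on `Γ_(K(E[2^M]))` and is Kummer at every place over `2N`
is `0`» — VERBATIM the conclusion of `GenusExact.NonPhantomPow.nonPhantomAtTwo_of_hasMultiplicativeReductionAt` (with `N := N_E`).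
Proofs below are the landed ones VERBATIM except that (i) the binder quadruple is gone and `hNPh` is inserted right after the two
`¬ IsSquare` clauses (where `K` is in scope), (ii) at the entry points the local `(NPh_M)` is read off `hNPh` instead of the multiplicative
prime, (iii) callees are the `_flat` siblings.  Decl names = originals + `_flat`; namespaces unchanged.

WHAT (this part).  The Δ>0 (transposition-type Kolyvagin primes) sockets of road (E4)⁺: gk2-p3's `RelaxedCount.hbot_socket_margin_onHabitat_transposition`,
gk2-p2's `TransverseValue.hbot_socket_margin_onHabitat_of_three_le_transposition`, and the LEAD's (E4)⁺ capstone-with-sockets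
`pow_dvd_natCard_sha_of_sockets_of_rank_le_one_transposition` (entry points: the single-level `(NPh_L)` is now `hNPh L`).

References: [GrossLMS1991] §1, §5, §10; [Kolyvagin1990] Thm. A; [McCallumLMS1991] §1, §3, §5; [Kramer1981] Thm. 1; [LawsonWuthrich2016] §4, §8
(the level-2 phantom class that supplies `(NPh at 2N)` off the cut — LINE 26 stubs `stub_KLW` / `stub_transport`, other seats).
-/

set_option autoImplicit false
-- the Theorems namespace of this sub repeats the summit name by design (D-0017 nested layout)
set_option linter.dupNamespace false

noncomputable section

/-! ## from `GenusKolyvaginAtTwoPowDvdShaCardAtTwoPosTE4PosOfSockets` -/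

open scoped Classical
open scoped AddSubgroup
open Function Field NumberField IsDedekindDomain WeierstrassCurve
open Literature.NumberTheory.EllipticCurves Literature.NumberTheory.GaloisRepresentations
open Literature.NumberTheory.EllipticCurves.ModularForms
open Literature.NumberTheory.GaloisCohomology
open Summit.BirchSwinnertonDyer.Rank1Residual.JET.GlobalDuality
open Summit.BirchSwinnertonDyer.BirchSwinnertonDyer.Theses.GenusKolyvaginAtTwo
open Summit.BirchSwinnertonDyer.Rank1Residual

namespace Summit.BirchSwinnertonDyer.BirchSwinnertonDyer.Theorems.GenusExact.PlusDescent

/-- (LINE 26 FLAT form: the hypothesis `(NPh at 2N)(E, K)` replaces the odd multiplicative prime `v`.) **ROAD (E4)⁺ ASSEMBLED MODULO ITS FOUR SOCKETS: `2^(2M₀) ∣ #Ш(E/K)[2^∞]` on the K-side of the restated L⁺_T′ frame, ANY sign of `Δ`, given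
`rank E(K) ≤ 1`.**  See the module docstring for the frame, the sockets (`hCheb`, `hbot`, `hswap`, `hK` — stated at the level `L = 2(M₀+6)` with margin `1` over the
class `L + 1 ≤ idx ∧ TRANSP`) and the composition.  NO sign-specific input remains outside the sockets; BSD is not proved by this.
[cite: McCallumLMS1991, §5 Prop. 5.2, Thm. 5.4 (p. 310)] [cite: Kolyvagin1991StructureSha] [cite: Kolyvagin1991MathAnn, Thm. 2.1–2.2]
[cite: GrossLMS1991, §1 Thm. 1.3, §10] [cite: Kramer1981, Thm. 1] -/
theorem pow_dvd_natCard_sha_of_sockets_of_rank_le_one_transposition_flat (hQ2 : KolyvaginRelationAtTwo)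
    (W : WeierstrassCurve ℚ) [W.IsElliptic] [W.IsGloballyMinimal] [NeZero (W.conductorNorm ℤ)] (hcm : ¬ W.HasCM)
    (hT : Odd W.tamagawaProduct)
    (K : Type) [Field K] [NumberField K] (hIQ : IsImaginaryQuadratic K) (hodd : Odd (NumberField.discr K))
    (h3 : NumberField.discr K ≠ -3) (hHe : SatisfiesHeegnerHypothesis (W.conductorNorm ℤ) K)
    (_hsq1 : ¬ IsSquare ((NumberField.discr K : ℚ) * -|W.Δ|)) (_hsq2 : ¬ IsSquare ((NumberField.discr K : ℚ) * (-(2 * |W.Δ|))))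
    (hNPh : ∀ (Mlev : ℕ), 1 ≤ Mlev → ∀ z : galH1Torsion (W.baseChange K) ((2 ^ Mlev : ℕ) : ℤ),
      (∀ ρ ∈ torsionFixing (W.baseChange K) ((2 ^ Mlev : ℕ) : ℤ), h1Eval (W.baseChange K) ((2 ^ Mlev : ℕ) : ℤ) z ρ = 0) →
      (∀ w : HeightOneSpectrum (𝓞 K), ((2 * W.conductorNorm ℤ : ℕ) : 𝓞 K) ∈ w.asIdeal →
        z ∈ selmerLocalKer (W.baseChange K) (w.adicCompletion K) ((2 ^ Mlev : ℕ) : ℤ)) → z = 0)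
    (hρ : ∀ n : ℕ, 0 < n → W.HasSurjectiveModNGaloisRep ((2 : ℤ) ^ n))
    (Dt : ModularParametrizationData W (W.conductorNorm ℤ)) (β : ℤ) (ι : K →+* ℂ) (d₁ : KolyvaginHeegnerData Dt β ι 1)
    (hy : ¬ IsOfFinAddOrder d₁.derivedPoint) (M₀ : ℕ)
    (hdiv : ∃ Q : (W.baseChange (ringClassField K ι 1)).toAffine.Point, ((2 ^ M₀ : ℕ) : ℤ) • Q = d₁.derivedPoint)
    (hndiv : ¬ ∃ Q : (W.baseChange (ringClassField K ι 1)).toAffine.Point, ((2 ^ (M₀ + 1) : ℕ) : ℤ) • Q = d₁.derivedPoint)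
    (hrk : (W.baseChange K).mordellWeilRank ≤ 1)
    (τ : K ≃ₐ[ℚ] K) (hτ : τ ≠ 1)
    -- socket 1 (gk2-p5 g32): the deep full-order signed pair Čebotarev at transposition-deep primes, level `L = 2(M₀+6)`, margin `1`
    (hCheb : ∀ (x y : galH1Torsion (W.baseChange K) ((2 ^ (2 * (M₀ + 6)) : ℕ) : ℤ)) {m κ : ℕ}, 1 ≤ m → 1 ≤ κ →
      addOrderOf x = 2 ^ m → addOrderOf y = 2 ^ κ → ∀ {sx sy : ℤ}, (sx = 1 ∨ sx = -1) → (sy = 1 ∨ sy = -1) →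
      conjAct W τ ((2 ^ (2 * (M₀ + 6)) : ℕ) : ℤ) x = sx • x → conjAct W τ ((2 ^ (2 * (M₀ + 6)) : ℕ) : ℤ) y = sy • y →
      (∀ a b : ℤ, (∀ ρ ∈ torsionFixing (W.baseChange K) ((2 ^ (2 * (M₀ + 6) + 1) : ℕ) : ℤ),
        h1Eval (W.baseChange K) ((2 ^ (2 * (M₀ + 6) + 1) : ℕ) : ℤ)
          (torsionH1OfDvd (W.baseChange K) (natCast_pow_dvd_natCast_pow_add 2 (2 * (M₀ + 6)) 1) (a • x + b • y)) ρ = 0) →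
        a • x + b • y = 0) →
      ∀ X : Finset ℕ, ∃ ℓ : ℕ, ℓ ∉ X ∧ Zhang2014.IsKolyvaginPrime (W.conductorNorm ℤ) W K 2 ℓ ∧
        2 * (M₀ + 6) + 1 ≤ Zhang2014.kolyvaginIndex W 2 ℓ ∧
        (∃ (v : HeightOneSpectrum (𝓞 ℚ)) (𝔓 : Ideal (absIntegers (𝓞 ℚ) ℚ)) (h : absoluteGaloisGroup ℚ),
          (ℓ : 𝓞 ℚ) ∈ v.asIdeal ∧ 𝔓 ∈ v.primesAbove ∧ IsArithFrobAt (𝓞 ℚ) h 𝔓 ∧ ∃ u : geomTorsion W 2, h • u ≠ u) ∧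
        ∀ v : HeightOneSpectrum (𝓞 K), (ℓ : 𝓞 K) ∈ v.asIdeal →
          (∀ j : ℕ, ((2 ^ j : ℕ) : ℤ) • x ∈ (W.baseChange K).torsionLocalKer (v.adicCompletion K) ((2 ^ (2 * (M₀ + 6)) : ℕ) : ℤ) ↔ m ≤ j) ∧
          ∀ j : ℕ, ((2 ^ j : ℕ) : ℤ) • y ∈ (W.baseChange K).torsionLocalKer (v.adicCompletion K) ((2 ^ (2 * (M₀ + 6)) : ℕ) : ℤ) ↔ κ ≤ j)
    -- socket 2 (gk2-p3, hbot⁺): a 2-primitive bottom rung in the margin class (from L⁺_T′'s transposition-deep witness `P(n₀) ∉ 2E(K[n₀])`)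
    (hbot : ∃ (n : ℕ) (d : KolyvaginHeegnerData Dt β ι n), Squarefree n ∧
      (∀ q ∈ n.primeFactors, (Zhang2014.IsKolyvaginPrime (W.conductorNorm ℤ) W K 2 q ∧ 2 * (M₀ + 6) ≤ Zhang2014.kolyvaginIndex W 2 q) ∧
        (2 * (M₀ + 6) + 1 ≤ Zhang2014.kolyvaginIndex W 2 q ∧
          ∃ (v : HeightOneSpectrum (𝓞 ℚ)) (𝔓 : Ideal (absIntegers (𝓞 ℚ) ℚ)) (h : absoluteGaloisGroup ℚ),
            (q : 𝓞 ℚ) ∈ v.asIdeal ∧ 𝔓 ∈ v.primesAbove ∧ IsArithFrobAt (𝓞 ℚ) h 𝔓 ∧ ∃ u : geomTorsion W 2, h • u ≠ u)) ∧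
      addOrderOf (d.kolyvaginClass Nat.prime_two (2 * (M₀ + 6))) = 2 ^ (2 * (M₀ + 6)))
    -- socket 3 (gk2-p5 g32, hswap⁺): the exact prime swap at transposition-deep primes
    (hswap : ∀ (r m : ℕ), 1 ≤ r → m < M₀ →
      (∀ (n : ℕ) (e : KolyvaginHeegnerData Dt β ι n), Squarefree n → n.primeFactors.card = r →
        (∀ q ∈ n.primeFactors, (Zhang2014.IsKolyvaginPrime (W.conductorNorm ℤ) W K 2 q ∧ 2 * (M₀ + 6) ≤ Zhang2014.kolyvaginIndex W 2 q) ∧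
          (2 * (M₀ + 6) + 1 ≤ Zhang2014.kolyvaginIndex W 2 q ∧
            ∃ (v : HeightOneSpectrum (𝓞 ℚ)) (𝔓 : Ideal (absIntegers (𝓞 ℚ) ℚ)) (h : absoluteGaloisGroup ℚ),
              (q : 𝓞 ℚ) ∈ v.asIdeal ∧ 𝔓 ∈ v.primesAbove ∧ IsArithFrobAt (𝓞 ℚ) h 𝔓 ∧ ∃ u : geomTorsion W 2, h • u ≠ u)) →
        ((2 ^ (2 * (M₀ + 6) - m) : ℕ) : ℤ) • e.kolyvaginClass Nat.prime_two (2 * (M₀ + 6)) = 0) →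
      ∀ (n : ℕ) (d : KolyvaginHeegnerData Dt β ι n), Squarefree n → n.primeFactors.card = r →
      (∀ q ∈ n.primeFactors, (Zhang2014.IsKolyvaginPrime (W.conductorNorm ℤ) W K 2 q ∧ 2 * (M₀ + 6) ≤ Zhang2014.kolyvaginIndex W 2 q) ∧
        (2 * (M₀ + 6) + 1 ≤ Zhang2014.kolyvaginIndex W 2 q ∧
          ∃ (v : HeightOneSpectrum (𝓞 ℚ)) (𝔓 : Ideal (absIntegers (𝓞 ℚ) ℚ)) (h : absoluteGaloisGroup ℚ),
            (q : 𝓞 ℚ) ∈ v.asIdeal ∧ 𝔓 ∈ v.primesAbove ∧ IsArithFrobAt (𝓞 ℚ) h 𝔓 ∧ ∃ u : geomTorsion W 2, h • u ≠ u)) →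
      addOrderOf (d.kolyvaginClass Nat.prime_two (2 * (M₀ + 6))) = 2 ^ (2 * (M₀ + 6) - m) →
      ∀ ℓ₀ ∈ n.primeFactors, ∀ X : Finset ℕ, ∃ ℓ' : ℕ, ℓ' ∉ X ∧ ℓ' ∉ n.primeFactors ∧
        ((Zhang2014.IsKolyvaginPrime (W.conductorNorm ℤ) W K 2 ℓ' ∧ 2 * (M₀ + 6) ≤ Zhang2014.kolyvaginIndex W 2 ℓ') ∧
          (2 * (M₀ + 6) + 1 ≤ Zhang2014.kolyvaginIndex W 2 ℓ' ∧
            ∃ (v : HeightOneSpectrum (𝓞 ℚ)) (𝔓 : Ideal (absIntegers (𝓞 ℚ) ℚ)) (h : absoluteGaloisGroup ℚ),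
              (ℓ' : 𝓞 ℚ) ∈ v.asIdeal ∧ 𝔓 ∈ v.primesAbove ∧ IsArithFrobAt (𝓞 ℚ) h 𝔓 ∧ ∃ u : geomTorsion W 2, h • u ≠ u)) ∧
        (∃ v : HeightOneSpectrum (𝓞 K), ((ℓ' : ℕ) : 𝓞 K) ∈ v.asIdeal ∧
          ((2 ^ (2 * (M₀ + 6) - m - 1) : ℕ) : ℤ) • d.kolyvaginClass Nat.prime_two (2 * (M₀ + 6)) ∉
            (W.baseChange K).torsionLocalKer (v.adicCompletion K) ((2 ^ (2 * (M₀ + 6)) : ℕ) : ℤ)) ∧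
        ∃ d' : KolyvaginHeegnerData Dt β ι (ℓ' * (n / ℓ₀)),
          ((2 ^ (2 * (M₀ + 6) - m - 1) : ℕ) : ℤ) • d'.kolyvaginClass Nat.prime_two (2 * (M₀ + 6)) ≠ 0)
    -- socket 4 (gk2-p4 g24, hK⁺): the eigen index law at a transposition-deep prime
    (hK : ∀ (r ℓ : ℕ), (Zhang2014.IsKolyvaginPrime (W.conductorNorm ℤ) W K 2 ℓ ∧ 2 * (M₀ + 6) ≤ Zhang2014.kolyvaginIndex W 2 ℓ) ∧
        (2 * (M₀ + 6) + 1 ≤ Zhang2014.kolyvaginIndex W 2 ℓ ∧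
          ∃ (v : HeightOneSpectrum (𝓞 ℚ)) (𝔓 : Ideal (absIntegers (𝓞 ℚ) ℚ)) (h : absoluteGaloisGroup ℚ),
            (ℓ : 𝓞 ℚ) ∈ v.asIdeal ∧ 𝔓 ∈ v.primesAbove ∧ IsArithFrobAt (𝓞 ℚ) h 𝔓 ∧ ∃ u : geomTorsion W 2, h • u ≠ u) →
      ∀ C : AddSubgroup (galH1Torsion (W.baseChange K) ((2 ^ (2 * (M₀ + 6)) : ℕ) : ℤ)),
      (∀ c ∈ C, c ∈ selmerGroup (W.baseChange K) ((2 ^ (2 * (M₀ + 6)) : ℕ) : ℤ) ∧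
        conjAct W τ ((2 ^ (2 * (M₀ + 6)) : ℕ) : ℤ) c = (-W.rootNumber * (-1) ^ r) • c) →
      (⨅ (v : HeightOneSpectrum (𝓞 K)) (_ : ((ℓ : ℕ) : 𝓞 K) ∈ v.asIdeal),
          (W.baseChange K).torsionLocalKer (v.adicCompletion K) ((2 ^ (2 * (M₀ + 6)) : ℕ) : ℤ)).relIndex
        (C ⊓ AddSubgroup.torsionBy (galH1Torsion (W.baseChange K) ((2 ^ (2 * (M₀ + 6)) : ℕ) : ℤ)) (2 : ℤ)) ∣ 2) :
    2 ^ (2 * M₀) ∣ Nat.card (AddCommGroup.primaryComponent (W.baseChange K).sha 2) := by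
  haveI : Fact (Nat.Prime 2) := ⟨Nat.prime_two⟩
  haveI : ∀ j : ℕ, NumberField (ringClassField K ι j) := JET.numberField_ringClassField K hIQ ι
  have hsurN : ∀ m : ℕ, W.HasSurjectiveModNGaloisRep ((2 ^ m : ℕ) : ℤ) :=
    MinimalTwinBSDTwo.forall_hasSurjectiveModNGaloisRep_two_pow_of_pos W hρ
  have hsurN' : ∀ m : ℕ, W.HasSurjectiveModNGaloisRep (2 ^ m : ℕ) := fun m ↦ by exact_mod_cast hsurN m
  -- X-ORTH∃ of (E4)⁺ at `k := M₀ + 6` (sign-free, transposition provenance)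
  obtain ⟨B, hker, hOrth⟩ := ctOrthogonalAtTwo_of_frame_transposition W hT K hIQ hodd h3 hHe hρ Dt β ι τ hτ (M₀ + 6) (by omega)
  -- (NPh_{L+1}) from the odd multiplicative place
  have hNPh := hNPh (2 * (M₀ + 6) + 1) (by omega)
  -- KS⁺: the integrator over the transposition-deep margin class, fed with the four sockets
  obtain ⟨R, Mr, hMr, hMr0, hMrR, hOdd, hEven⟩ := kolyvaginSuppliesAtTwo_of_deepSwap_transposition W hQ2 hcm hT hsurN' hIQ hodd h3 hHe τ hτ
    Dt β ι d₁ M₀ hdiv hndiv (L := 2 * (M₀ + 6)) (by omega) 1 (fun z hz hzS ↦ hNPh z hz fun w _ ↦ hzS w) hCheb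
    (fun q ↦ 2 * (M₀ + 6) + 1 ≤ Zhang2014.kolyvaginIndex W 2 q ∧
      ∃ (v : HeightOneSpectrum (𝓞 ℚ)) (𝔓 : Ideal (absIntegers (𝓞 ℚ) ℚ)) (h : absoluteGaloisGroup ℚ),
        (q : 𝓞 ℚ) ∈ v.asIdeal ∧ 𝔓 ∈ v.primesAbove ∧ IsArithFrobAt (𝓞 ℚ) h 𝔓 ∧ ∃ u : geomTorsion W 2, h • u ≠ u)
    (fun q _ hidx hF ↦ ⟨hidx, hF⟩) hbot hswap hK
  -- the sign-free capstone with `Xp = Xm :=` the margin class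
  refine pow_dvd_natCard_sha_of_kolyvaginSupplies_of_orthogonal_of_rank_le_one hQ2 W hcm hT K hIQ hodd h3 hHe hrk hρ Dt β ι d₁ hy M₀ hndiv
    τ hτ (2 * (M₀ + 6)) (M₀ + 6) (by omega) (by omega)
    (fun ℓ ↦ 2 * (M₀ + 6) + 1 ≤ Zhang2014.kolyvaginIndex W 2 ℓ ∧
      ∃ (v : HeightOneSpectrum (𝓞 ℚ)) (𝔓 : Ideal (absIntegers (𝓞 ℚ) ℚ)) (h : absoluteGaloisGroup ℚ),
        (ℓ : 𝓞 ℚ) ∈ v.asIdeal ∧ 𝔓 ∈ v.primesAbove ∧ IsArithFrobAt (𝓞 ℚ) h 𝔓 ∧ ∃ u : geomTorsion W 2, h • u ≠ u)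
    (fun ℓ ↦ 2 * (M₀ + 6) + 1 ≤ Zhang2014.kolyvaginIndex W 2 ℓ ∧
      ∃ (v : HeightOneSpectrum (𝓞 ℚ)) (𝔓 : Ideal (absIntegers (𝓞 ℚ) ℚ)) (h : absoluteGaloisGroup ℚ),
        (ℓ : 𝓞 ℚ) ∈ v.asIdeal ∧ 𝔓 ∈ v.primesAbove ∧ IsArithFrobAt (𝓞 ℚ) h 𝔓 ∧ ∃ u : geomTorsion W 2, h • u ≠ u)
    B hker (fun x x' hx hx' ↦ ?_) R Mr hMr hMr0 hMrR hOdd hEven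
  -- X-ORTH in provenance currency: drop the margin (the transposition clause is level-free)
  obtain ⟨n₁, e₁, j₁, hn₁, hKol₁, hj₁, hsel₁, hvan₁, hsg₁, hx₁⟩ := hx
  obtain ⟨n₂, e₂, j₂, hn₂, hKol₂, hj₂, hsel₂, hvan₂, hsg₂, hx₂⟩ := hx'
  exact hOrth x x'
    ⟨n₁, e₁, j₁, hn₁, fun ℓ hℓ ↦ ⟨(hKol₁ ℓ hℓ).1, (hKol₁ ℓ hℓ).2.1, (hKol₁ ℓ hℓ).2.2.2⟩, hj₁, hsel₁, hvan₁, hsg₁, hx₁⟩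
    ⟨n₂, e₂, j₂, hn₂, fun ℓ hℓ ↦ ⟨(hKol₂ ℓ hℓ).1, (hKol₂ ℓ hℓ).2.1, (hKol₂ ℓ hℓ).2.2.2⟩, hj₂, hsel₂, hvan₂, hsg₂, hx₂⟩

end Summit.BirchSwinnertonDyer.BirchSwinnertonDyer.Theorems.GenusExact.PlusDescent

/-! ## from `GenusKolyvaginAtTwoPowDvdShaCardAtTwoPosTBottomRungSocketTransposition` -/

open scoped Classical

open Field NumberField IsDedekindDomain Function WeierstrassCurve
open Literature.NumberTheory.EllipticCurves
open Literature.NumberTheory.GaloisRepresentations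
open Literature.NumberTheory.GaloisCohomology
open Summit.BirchSwinnertonDyer.BirchSwinnertonDyer.Theses.GenusKolyvaginAtTwo (KolyvaginRelationAtTwo)

namespace Summit.BirchSwinnertonDyer.BirchSwinnertonDyer.Theorems.GenusExact.RelaxedCount

variable (W : WeierstrassCurve ℚ) [W.IsElliptic] [W.IsGloballyMinimal] [NeZero (W.conductorNorm ℤ)]
  {K : Type} [Field K] [NumberField K]

/-- (LINE 26 FLAT form: the hypothesis `(NPh at 2N)(E, K)` replaces the odd multiplicative prime `v`.) **THE SOCKET `hbot`, margin-`k` class, ON THE CUT HABITAT** («∃ odd place `v ∣ N` of multiplicative reduction», director (D-NPh)): as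
`hbot_socket_margin`, with (NPh) DISCHARGED by gk2-p3's `nonPhantomAtTwo_of_hasMultiplicativeReductionAt`, the witness in Kolyvagin's divisibility
currency `P(n₀) ∉ 2E(K[n₀])`, and LEVEL-2 Gross primes of index `≥ 2` (the level-4 condition follows on `Δ < 0` with the 2-adic tower onto,
gk2-p5 g22).  Displayed residuals: the (V44)-socket `hTr` at level `L + k` and Q2.
[cite: McCallumLMS1991, §5 Prop. 5.2 and its proof, p. 285] [cite: GrossLMS1991, §3 (3.3)] -/
theorem hbot_socket_margin_onHabitat_transposition_flat (hQ2 : KolyvaginRelationAtTwo) (hcm : ¬ W.HasCM)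
    (hT : Odd W.tamagawaProduct) (hρ : ∀ m : ℕ, W.HasSurjectiveModNGaloisRep (2 ^ m : ℕ))
    (hK : IsImaginaryQuadratic K) (hodd : Odd (NumberField.discr K)) (h3 : NumberField.discr K ≠ -3)
    (hHe : SatisfiesHeegnerHypothesis (W.conductorNorm ℤ) K) (_hns : ¬ IsSquare ((NumberField.discr K : ℚ) * -|W.Δ|))
    (_hns₂ : ¬ IsSquare ((NumberField.discr K : ℚ) * (-(2 * |W.Δ|))))
    (hNPh : ∀ (Mlev : ℕ), 1 ≤ Mlev → ∀ z : galH1Torsion (W.baseChange K) ((2 ^ Mlev : ℕ) : ℤ),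
      (∀ ρ ∈ torsionFixing (W.baseChange K) ((2 ^ Mlev : ℕ) : ℤ), h1Eval (W.baseChange K) ((2 ^ Mlev : ℕ) : ℤ) z ρ = 0) →
      (∀ w : HeightOneSpectrum (𝓞 K), ((2 * W.conductorNorm ℤ : ℕ) : 𝓞 K) ∈ w.asIdeal →
        z ∈ selmerLocalKer (W.baseChange K) (w.adicCompletion K) ((2 ^ Mlev : ℕ) : ℤ)) → z = 0)
    (Dt : ModularForms.ModularParametrizationData W (W.conductorNorm ℤ)) (β : ℤ) (ι : K →+* ℂ) {L : ℕ} (hL2 : 2 ≤ L) (k : ℕ)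
    (hTr : ∀ (n' : ℕ) (d' : KolyvaginHeegnerData Dt β ι n') (Z : galoisCohomology (W.torsionGaloisModule ((2 ^ 2 : ℕ) : ℤ)) 1),
      Squarefree n' →
      (∀ q ∈ n'.primeFactors, Zhang2014.IsKolyvaginPrime (W.conductorNorm ℤ) W K 2 q ∧ 2 ≤ Zhang2014.kolyvaginIndex W 2 q ∧
        (∃ (v : HeightOneSpectrum (𝓞 ℚ)) (𝔓 : Ideal (absIntegers (𝓞 ℚ) ℚ)) (h : absoluteGaloisGroup ℚ),
          (q : 𝓞 ℚ) ∈ v.asIdeal ∧ 𝔓 ∈ v.primesAbove ∧ IsArithFrobAt (𝓞 ℚ) h 𝔓 ∧ ∃ u : geomTorsion W 2, h • u ≠ u)) →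
      resTorsion W K ((2 ^ 2 : ℕ) : ℤ) Z = d'.kolyvaginClass Nat.prime_two 2 →
      ∀ (v : HeightOneSpectrum (𝓞 ℚ)) (ℓ : ℕ), ℓ ∈ n'.primeFactors → (ℓ : 𝓞 ℚ) ∈ v.asIdeal →
        L + k ≤ Zhang2014.kolyvaginIndex W 2 ℓ →
        ∀ 𝔓 ∈ v.primesAbove, ∀ F : absoluteGaloisGroup ℚ, IsArithFrobAt (𝓞 ℚ) F 𝔓 →
          ∃ P₁ : geomTorsion W ((2 ^ 2 : ℕ) : ℤ), h1Eval W _ ((2 : ℕ) • Z) F = F • P₁ - P₁)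
    (G : ℕ → Prop)
    (hG : ∀ q : ℕ, Zhang2014.IsKolyvaginPrime (W.conductorNorm ℤ) W K 2 q → L + k ≤ Zhang2014.kolyvaginIndex W 2 q →
      (∃ (v : HeightOneSpectrum (𝓞 ℚ)) (𝔓 : Ideal (absIntegers (𝓞 ℚ) ℚ)) (h : absoluteGaloisGroup ℚ),
        (q : 𝓞 ℚ) ∈ v.asIdeal ∧ 𝔓 ∈ v.primesAbove ∧ IsArithFrobAt (𝓞 ℚ) h 𝔓 ∧ ∃ u : geomTorsion W 2, h • u ≠ u) → G q)
    {n₀ : ℕ} (hn₀ : Squarefree n₀)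
    (hn₀K : ∀ q ∈ n₀.primeFactors, Zhang2014.IsKolyvaginPrime (W.conductorNorm ℤ) W K 2 q ∧ 2 ≤ Zhang2014.kolyvaginIndex W 2 q ∧
      (∃ (v : HeightOneSpectrum (𝓞 ℚ)) (𝔓 : Ideal (absIntegers (𝓞 ℚ) ℚ)) (h : absoluteGaloisGroup ℚ),
        (q : 𝓞 ℚ) ∈ v.asIdeal ∧ 𝔓 ∈ v.primesAbove ∧ IsArithFrobAt (𝓞 ℚ) h 𝔓 ∧ ∃ u : geomTorsion W 2, h • u ≠ u))
    (e₀ : KolyvaginHeegnerData Dt β ι n₀)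
    (he₀ : ¬ ∃ Q : (W.baseChange (ringClassField K ι n₀)).toAffine.Point, (2 : ℤ) • Q = e₀.derivedPoint) :
    ∃ (n : ℕ) (d : KolyvaginHeegnerData Dt β ι n), Squarefree n ∧
      (∀ q ∈ n.primeFactors, (Zhang2014.IsKolyvaginPrime (W.conductorNorm ℤ) W K 2 q ∧ L ≤ Zhang2014.kolyvaginIndex W 2 q) ∧ G q) ∧
      addOrderOf (d.kolyvaginClass Nat.prime_two L) = 2 ^ L := by
  have hρ2 : W.HasSurjectiveModNGaloisRep 2 := by simpa using hρ 1
  have hNPh := hNPh (L + k) (by omega)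
  have he₀' : addOrderOf (e₀.kolyvaginClass Nat.prime_two 2) = 2 ^ 2 :=
    addOrderOf_kolyvaginClass_two_eq_pow_of_not_two_dvd_single W hK hodd h3 hHe hρ2 Dt β ι (M := 2) (by norm_num) hn₀
      (fun q hq ↦ ⟨(hn₀K q hq).1, (hn₀K q hq).2.1⟩) e₀ he₀
  exact hbot_socket_margin_transposition W hQ2 hcm hT hρ hK hodd h3 hHe Dt β ι hL2 k hNPh hTr G hG hn₀ hn₀K e₀ he₀'

end Summit.BirchSwinnertonDyer.BirchSwinnertonDyer.Theorems.GenusExact.RelaxedCount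

/-! ## from `GenusKolyvaginAtTwoPowDvdShaCardAtTwoPosTBottomRungTransverseSocketTransposition` -/

open scoped Classical Pointwise

open WeierstrassCurve NumberField IsDedekindDomain Field
open Literature.NumberTheory.EllipticCurves Literature.NumberTheory.GaloisRepresentations
open Literature.NumberTheory.GaloisCohomology
open Literature.NumberTheory.EllipticCurves.ModularForms
open Summit.BirchSwinnertonDyer.Rank1Residual
open Summit.BirchSwinnertonDyer.BirchSwinnertonDyer.Theses.GenusKolyvaginAtTwo (KolyvaginRelationAtTwo)

namespace Summit.BirchSwinnertonDyer.BirchSwinnertonDyer.Theorems.GenusExact.TransverseValue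

section Socket

variable {K : Type} [Field K] [NumberField K] (W : WeierstrassCurve ℚ) [W.IsElliptic] [W.IsGloballyMinimal]
  [NeZero (W.conductorNorm ℤ)]

/-- (LINE 26 FLAT form: the hypothesis `(NPh at 2N)(E, K)` replaces the odd multiplicative prime `v`.) **§3 THE SOCKET `hbot⁺`, margin-`k` class, ON THE CUT HABITAT, WITH `hTr⁺` DISCHARGED — any sign of `Δ`** (gk2-p2 g22's contract: with
`L := 2(M₀+6)`, `k := 1`, `G q := L + 1 ≤ idx q ∧ TRANSP q`, `hG := fun q _ hidx hF ↦ ⟨hidx, hF⟩` this is VERBATIM the binder `hbot` of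
`PlusDescent.pow_dvd_natCard_sha_of_sockets_of_rank_le_one_transposition_flat`): layer 10's `RelaxedCount.hbot_socket_margin_onHabitat_transposition_flat`
(«∃ odd place `v ∣ N` of multiplicative reduction» + the two non-squares of the frame discharge (NPh) by
`NonPhantomPow.nonPhantomAtTwo_of_hasMultiplicativeReductionAt`; witness `P(n₀) ∉ 2E(K[n₀])` at transposition-deep Zhang–Kolyvagin primes of
index `≥ 2`) composed with `hTr_of_three_le_transposition`.  Displayed residual: Q2 only.
[cite: McCallumLMS1991, §5 Prop. 5.2 and its proof, p. 285] [cite: GrossLMS1991, §3 (3.1)–(3.3)] -/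
theorem hbot_socket_margin_onHabitat_of_three_le_transposition_flat (hQ2 : KolyvaginRelationAtTwo) (hcm : ¬ W.HasCM)
    (hT : Odd W.tamagawaProduct) (hρ : ∀ m : ℕ, W.HasSurjectiveModNGaloisRep (2 ^ m : ℕ))
    (hK : IsImaginaryQuadratic K) (hodd : Odd (NumberField.discr K)) (h3 : NumberField.discr K ≠ -3)
    (hHe : SatisfiesHeegnerHypothesis (W.conductorNorm ℤ) K) (hns : ¬ IsSquare ((NumberField.discr K : ℚ) * -|W.Δ|))
    (hns₂ : ¬ IsSquare ((NumberField.discr K : ℚ) * (-(2 * |W.Δ|))))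
    (hNPh : ∀ (Mlev : ℕ), 1 ≤ Mlev → ∀ z : galH1Torsion (W.baseChange K) ((2 ^ Mlev : ℕ) : ℤ),
      (∀ ρ ∈ torsionFixing (W.baseChange K) ((2 ^ Mlev : ℕ) : ℤ), h1Eval (W.baseChange K) ((2 ^ Mlev : ℕ) : ℤ) z ρ = 0) →
      (∀ w : HeightOneSpectrum (𝓞 K), ((2 * W.conductorNorm ℤ : ℕ) : 𝓞 K) ∈ w.asIdeal →
        z ∈ selmerLocalKer (W.baseChange K) (w.adicCompletion K) ((2 ^ Mlev : ℕ) : ℤ)) → z = 0)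
    (Dt : ModularParametrizationData W (W.conductorNorm ℤ)) (β : ℤ) (ι : K →+* ℂ)
    [∀ j : ℕ, NumberField (ringClassField K ι j)] {L : ℕ} (hL2 : 2 ≤ L) (k : ℕ) (hLk : 3 ≤ L + k)
    (G : ℕ → Prop)
    (hG : ∀ q : ℕ, Zhang2014.IsKolyvaginPrime (W.conductorNorm ℤ) W K 2 q → L + k ≤ Zhang2014.kolyvaginIndex W 2 q →
      (∃ (v : HeightOneSpectrum (𝓞 ℚ)) (𝔓 : Ideal (absIntegers (𝓞 ℚ) ℚ)) (h : absoluteGaloisGroup ℚ),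
        (q : 𝓞 ℚ) ∈ v.asIdeal ∧ 𝔓 ∈ v.primesAbove ∧ IsArithFrobAt (𝓞 ℚ) h 𝔓 ∧ ∃ u : geomTorsion W 2, h • u ≠ u) → G q)
    {n₀ : ℕ} (hn₀ : Squarefree n₀)
    (hn₀K : ∀ q ∈ n₀.primeFactors, Zhang2014.IsKolyvaginPrime (W.conductorNorm ℤ) W K 2 q ∧ 2 ≤ Zhang2014.kolyvaginIndex W 2 q ∧
      (∃ (v : HeightOneSpectrum (𝓞 ℚ)) (𝔓 : Ideal (absIntegers (𝓞 ℚ) ℚ)) (h : absoluteGaloisGroup ℚ),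
        (q : 𝓞 ℚ) ∈ v.asIdeal ∧ 𝔓 ∈ v.primesAbove ∧ IsArithFrobAt (𝓞 ℚ) h 𝔓 ∧ ∃ u : geomTorsion W 2, h • u ≠ u))
    (e₀ : KolyvaginHeegnerData Dt β ι n₀)
    (he₀ : ¬ ∃ Q : (W.baseChange (ringClassField K ι n₀)).toAffine.Point, (2 : ℤ) • Q = e₀.derivedPoint) :
    ∃ (n : ℕ) (d : KolyvaginHeegnerData Dt β ι n), Squarefree n ∧
      (∀ q ∈ n.primeFactors, (Zhang2014.IsKolyvaginPrime (W.conductorNorm ℤ) W K 2 q ∧ L ≤ Zhang2014.kolyvaginIndex W 2 q) ∧ G q) ∧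
      addOrderOf (d.kolyvaginClass Nat.prime_two L) = 2 ^ L :=
  RelaxedCount.hbot_socket_margin_onHabitat_transposition_flat W hQ2 hcm hT hρ hK hodd h3 hHe hns hns₂ hNPh Dt β ι hL2 k
    (hTr_of_three_le_transposition' W hK hodd h3 Dt β ι hLk) G hG hn₀ hn₀K e₀ he₀

end Socket

end Summit.BirchSwinnertonDyer.BirchSwinnertonDyer.Theorems.GenusExact.TransverseValue

end
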